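import Literature.IUT.HodgeTheaters.InitialThetaDataTorsionCuspModelPointGeometry
import Literature.IUT.HodgeTheaters.InitialThetaDataCuspNormaliserLaw
import HarnessLib

/-!
# [IUTchI] Def 6.1 (v): abc-iut-L5-t4's `CuspClassesNormaliserStable` (`hS`) HOLDS at the single-point cusp model
# `regeom₄` (NV-L5 row «JOINT-NV-CG (l cusps)», stage C part C4)

S. Mochizuki, *Inter-universal Teichmüller theory I*, kurims manuscript (May 2020), Def 6.1 (v) p. 158 («the subgroup
`Aut_±(𝒟^{⊚±}) ⊆ Aut(𝒟^{⊚±}) ⥲ Aut(X̲_K)`», «automorphisms that fix the cusps of `X̲_K`»), with §1 p. 38 («by considering the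
decomposition groups associated to the cusps of `X̲` lying over `2ε`»).  PARAPHRASE (ours, not print's words): the subgroup
`Π_{X̲_K}` and the decomposition groups of the cusps are respected by the automorphisms of `𝒟^{⊚±}` — typed as abc-iut-L5-t4's binder
`InitialThetaData.CuspClassesNormaliserStable` (`InitialThetaDataCuspNormaliserLaw.lean`): for `n ∈ N_{Π_{C_F}}(Π_{X̲_K})` and
every cusp `x`, `(t n)·embK(D_x)·(t n)⁻¹ = embK(D_y)` for some cusp `y` and `t ∈ Π_{X̲_K}`.  [claim: Mochizuki2012, status:
disputed] (D-0012 claim key; series status DISPUTED — a MODEL of the cell's `π₁`-interface structures; nothing of the series is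
asserted; no side taken on [IUTchIII] Cor. 3.12).

## WHAT (parts C1–C2: `pedOf₄`, `regeom₄` with SINGLE-POINT inertia `⟨((e_{s(q)}, 1), (γ, 1))⟩`)

* conjugation calculus in `Π_{C_F} = Del ⋊ (G_F × {±1})`: `outU_e` (`q·e_P = e_{q·P}^{ε(q)}`), `piC_conj_mk`, and
  **`conj_embK₃_igenP_zpow`**: for `n = ⟨δ_n, (σ, u)⟩` and `γ ∈ G_K`,
  `n · embK(γ, igenP_x^k) · n⁻¹ = ⟨(e_{(σ,u)·s(x) · t_n}^{u k}, 1), (σγσ⁻¹, 1)⟩` (`G_K = Ker ρ` is normal and acts trivially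
  on `Del`);
* `act_mem_zpowers_of_mem_normalizer`: `n ∈ N(Π_{X̲_K})` forces `(σ, u)` to preserve the line `ℤ·g` (test element
  `((0, g), 1) ∈ Π_{X̲_K}`);
* **`cuspClassesNormaliserStable₄`** (model level) and **`InitialThetaData.cuspClassesNormaliserStable_regeom₄ D₀ :
  D₀.regeom₄.CuspClassesNormaliserStable`**: with `P′ := (σ,u)·s(x)·t_n`, `y := [P′]`, `k₀ := s(y)⁻¹P′ ∈ ℤ·g` and
  `t := embK(1, ((0, k₀⁻¹), 1)) ∈ Π_{X̲_K}`, `(t n)·embK(D_x)·(t n)⁻¹ = embK(D_y)` EXACTLY;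
* the joint statement **`exists_cuspGalois_unramified_normaliserStable_regeom₄`**: `{CG, M′ ⊇ (M, hI), hS}` at ONE datum over
  the same `(V^bad_mod, V̲)` — so abc-iut-L5-d5's `Λ`-assembly `UnramifiedTorsionMonodromy.localArrowLaw_local CG hS …` FIRES
  non-vacuously (`nonempty_localArrowLaw_regeom₄`).  (`hL`/`hA` at `regeom₄` = part C3, the routine re-run of B5.)

HONEST LABEL «[model; `E[l]`-twisted finite shadow; single-point inertia; hS INHABITED]»; contrast: `hS` FAILS at the
difference-vector datum `regeom₃` (memo STEP0-jointNV-hS-singlepoint.md §1).  Model ≠ genuine datum; typed ≠ proved; no side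
taken on [IUTchIII] Cor. 3.12.
-/

noncomputable section

namespace Literature.IUT.HodgeTheaters

universe u

namespace TorsionCuspModel

open Literature.AnabelianGeometry.AbsoluteAnabelian Topology TorsionMonodromyModel ThetaGeometryModel
open Literature.AnabelianGeometry.EtaleTheta.SettingModel
open scoped WeierstrassCurve.Affine Classical Pointwise

variable {F : Type u} [Field F] {E : WeierstrassCurve F} {Fbar : Type u} [Field Fbar] [Algebra F Fbar] {l : ℕ}

/-! ## Conjugation calculus in `Π_{C_F} = Del ⋊ (G_F × {±1})` -/

/-- `q · e_P = e_{q·P}^{ε(q)}` (`ε(σ, u) = u`). [cite: Mochizuki2012, IUTchI Def 3.1 (c) p.62] -/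
theorem outU_e (q : GalPM F Fbar) (P : Tors E Fbar l) : outU E l q (U.e P) = U.e (act F E Fbar l q P) ^ ((q.2 : ℤ)) := by
  refine U.ext fun Q => ?_
  rw [toAdd_outU_apply, U.toAdd_e_apply, toAdd_zpow, Pi.smul_apply, U.toAdd_e_apply]
  by_cases h : Q = act F E Fbar l q P
  · rw [if_pos ((act F E Fbar l q).symm_apply_eq.mpr h), if_pos h, mul_one, zsmul_eq_mul, mul_one]; rfl
  · rw [if_neg (fun h' => h ((act F E Fbar l q).symm_apply_eq.mp h')), if_neg h, mul_zero, smul_zero]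

/-- Conjugation in `Π_{C_F}` when the conjugated Galois part acts trivially on `Del`:
`n·⟨δ, p⟩·n⁻¹ = ⟨δ_n · (q·δ) · δ_n⁻¹, q p q⁻¹⟩` (`q = n.right`). [cite: Mochizuki2012, IUTchI Def 3.1 (c) p.62] -/
theorem piC_conj_mk (n : PiC F E Fbar l) (δ : Del E Fbar l) (p : GalPM F Fbar)
    (hp : outer F E Fbar l (n.right * p * n.right⁻¹) = 1) :
    n * (⟨δ, p⟩ : PiC F E Fbar l) * n⁻¹ =
      ⟨n.left * outer F E Fbar l n.right δ * n.left⁻¹, n.right * p * n.right⁻¹⟩ := by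
  refine SemidirectProduct.ext ?_ ?_
  · rw [SemidirectProduct.mul_left, SemidirectProduct.mul_left, SemidirectProduct.inv_left, SemidirectProduct.mul_right,
      ← MulAut.mul_apply, ← map_mul, hp, MulAut.one_apply]
  · rw [SemidirectProduct.mul_right, SemidirectProduct.mul_right, SemidirectProduct.inv_right]

section Normaliser

variable {K : Type u} [Field K] [Algebra K Fbar] (hK : ∀ σ ∈ galoisSubgroupOf F K Fbar, FixesTorsion E l σ)
  {g : Tors E Fbar l} (s : Tors E Fbar l ⧸ Subgroup.zpowers g → Tors E Fbar l)

/-- `embK(γ, d) = ⟨d_{Del}, (γ, u_d)⟩`. [cite: Mochizuki2012, IUTchI Def 3.1 (d) p.62] -/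
theorem embK₃_apply (x : galoisSubgroupOf F K Fbar × DihU F E Fbar l) :
    embK₃ hK x = ⟨x.2.left, ((x.1 : Fbar ≃ₐ[F] Fbar), x.2.right)⟩ := rfl

/-- Local copy of abc-iut-w4-d077's `fixesTorsion_conj` (p470239; `G_K = Ker ρ` is normal in `G_F`), kept private to avoid
an import of the EVALSECT module. [cite: Mochizuki2012, IUTchI Def 3.1 (c) p.62] -/
private theorem fixesTorsion_conj' {σ : Fbar ≃ₐ[F] Fbar} (hσ : FixesTorsion E l σ) (ρ : Fbar ≃ₐ[F] Fbar) :
    FixesTorsion E l (ρ * σ * ρ⁻¹) := by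
  rw [← mem_ker_torsRep_iff E Fbar l] at hσ ⊢
  exact (MonoidHom.normal_ker (torsRep E Fbar l)).conj_mem σ hσ ρ

/-- **Conjugating a cuspidal decomposition element**: for `n = ⟨δ_n, (σ, u)⟩ ∈ Π_{C_F}` and `γ ∈ G_K`,
`n · embK(γ, igenP_x^k) · n⁻¹ = ⟨(e_{(σ,u)·s(x)·t_n}^{u·k}, 1), (σγσ⁻¹, 1)⟩`. [cite: Mochizuki2012, IUTchI Def 6.1 (v) p.158] -/
theorem conj_embK₃_igenP_zpow (n : PiC F E Fbar l) (γ : galoisSubgroupOf F K Fbar)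
    (x : Tors E Fbar l ⧸ Subgroup.zpowers g) (k : ℤ) :
    n * embK₃ hK (γ, igenP s x ^ k) * n⁻¹ =
      ⟨SemidirectProduct.inl (U.e (act F E Fbar l n.right (s x) * n.left.right) ^ ((n.right.2 : ℤ) * k)),
        n.right * ((γ : Fbar ≃ₐ[F] Fbar), 1) * n.right⁻¹⟩ := by
  have hp : outer F E Fbar l (n.right * ((γ : Fbar ≃ₐ[F] Fbar), 1) * n.right⁻¹) = 1 := by
    have e : n.right * ((γ : Fbar ≃ₐ[F] Fbar), (1 : ℤˣ)) * n.right⁻¹ = (n.right.1 * γ * n.right.1⁻¹, 1) := by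
      ext <;> simp
    rw [e]
    exact outer_eq_one_of_fixesTorsion (fixesTorsion_conj' (hK γ γ.2) n.right.1)
  rw [embK₃_apply, igenP, ← map_zpow, ← map_zpow, SemidirectProduct.left_inl, SemidirectProduct.right_inl,
    piC_conj_mk n _ _ hp, outer_inl, del_conj_inl, map_zpow, outU_e, ← zpow_mul, map_zpow, transl_e]

/-- The Galois part of `n` preserves the line: `n ∈ N(Π_{X̲_K})` ⇒ `(σ,u)·g ∈ ℤ·g` (test element `((0,g),1)`).
[cite: Mochizuki2012, IUTchI Def 6.1 (v) p.158] -/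
theorem act_mem_zpowers_of_mem_normalizer (G' : Subgroup (galoisSubgroupOf F K Fbar × DihU F E Fbar l))
    (hG' : ∀ y ∈ G', y.2.left.right ∈ Subgroup.zpowers g)
    (hg' : (((1 : galoisSubgroupOf F K Fbar), (SemidirectProduct.inl (SemidirectProduct.inr g) : DihU F E Fbar l)) ∈ G'))
    {n : PiC F E Fbar l} (hn : n ∈ Subgroup.normalizer ((G'.map (embK₃ hK) : Subgroup (PiC F E Fbar l)) : Set (PiC F E Fbar l)))
    (t : Tors E Fbar l) (ht : t ∈ Subgroup.zpowers g) : act F E Fbar l n.right t ∈ Subgroup.zpowers g := by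
  obtain ⟨k, rfl⟩ := Subgroup.mem_zpowers_iff.mp ht
  rw [map_zpow]
  refine Subgroup.zpow_mem _ ?_ k
  have hmem : n * embK₃ hK ((1 : galoisSubgroupOf F K Fbar), SemidirectProduct.inl (SemidirectProduct.inr g)) * n⁻¹ ∈
      (G'.map (embK₃ hK) : Subgroup (PiC F E Fbar l)) :=
    ((Subgroup.mem_normalizer_iff.mp hn) _).mp ⟨_, hg', rfl⟩
  obtain ⟨y, hy, hyeq⟩ := hmem
  have hp : outer F E Fbar l (n.right * (((1 : galoisSubgroupOf F K Fbar) : Fbar ≃ₐ[F] Fbar), 1) * n.right⁻¹) = 1 := by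
    rw [OneMemClass.coe_one, Prod.mk_one_one, mul_one, mul_inv_cancel, map_one]
  have hR := congrArg (fun z : PiC F E Fbar l => z.left.right) hyeq
  simp only [embK₃_apply] at hR
  rw [SemidirectProduct.left_inl, SemidirectProduct.right_inl, piC_conj_mk n _ _ hp, SemidirectProduct.mul_right,
    SemidirectProduct.mul_right, SemidirectProduct.inv_right, outer_apply_right, SemidirectProduct.right_inr,
    mul_inv_cancel_comm] at hR
  rw [← hR]
  exact hG' y hy

/-- **abc-iut-L5-t4's `hS` at the single-point model (model level)**: for `n ∈ N(embK(G_K × Π̄))` with `Π̄ = (U ⋊ ℤ·g) ⋊ 1`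
(the hypothesis is not even needed: in the model EVERY `n ∈ Π_{C_F}` permutes the cuspidal classes) and a cusp `x`: `(t n)·embK(G_K × ⟨igenP_x⟩)·(t n)⁻¹ = embK(G_K × ⟨igenP_y⟩)` with `y := [(σ,u)·s(x)·t_n]` and an explicit
`t ∈ embK(G_K × Π̄)`. [cite: Mochizuki2012, IUTchI Def 6.1 (v) p.158] -/
theorem cuspClassesNormaliserStable₄ (hK' : ∀ σ : Fbar ≃ₐ[F] Fbar, σ ∈ galoisSubgroupOf F K Fbar ↔ FixesTorsion E l σ)
    (hs : ∀ q : Tors E Fbar l ⧸ Subgroup.zpowers g, (QuotientGroup.mk (s q) : _ ⧸ Subgroup.zpowers g) = q)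
    (n : PiC F E Fbar l)
    (_hn : n ∈ Subgroup.normalizer (((liftU (galoisSubgroupOf F K Fbar) (dX F E Fbar l) ⊓
      liftU (galoisSubgroupOf F K Fbar) (dC F E g)).map (embK₃ hK) : Subgroup (PiC F E Fbar l)) : Set (PiC F E Fbar l)))
    (x : Tors E Fbar l ⧸ Subgroup.zpowers g) :
    ∃ y : Tors E Fbar l ⧸ Subgroup.zpowers g,
      ∃ t ∈ (liftU (galoisSubgroupOf F K Fbar) (dX F E Fbar l) ⊓ liftU (galoisSubgroupOf F K Fbar) (dC F E g)).map (embK₃ hK),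
        MulAut.conj (t * n) • ((liftU (galoisSubgroupOf F K Fbar) (Subgroup.zpowers (igenP (F := F) s x))).map (embK₃ hK)) =
          (liftU (galoisSubgroupOf F K Fbar) (Subgroup.zpowers (igenP (F := F) s y))).map (embK₃ hK) := by
  -- the new point, the new cusp, and the `ℤ·g`-correction
  obtain ⟨P', hP'⟩ : ∃ P' : Tors E Fbar l, P' = act F E Fbar l n.right (s x) * n.left.right := ⟨_, rfl⟩
  have hk₀ : (s (QuotientGroup.mk P'))⁻¹ * P' ∈ Subgroup.zpowers g := by
    rw [← QuotientGroup.eq_one_iff, QuotientGroup.mk_mul, QuotientGroup.mk_inv, hs, inv_mul_cancel]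
  obtain ⟨k₀, hk₀def⟩ : ∃ k₀ : Tors E Fbar l, k₀ = (s (QuotientGroup.mk P'))⁻¹ * P' := ⟨_, rfl⟩
  rw [← hk₀def] at hk₀
  let d₀ : DihU F E Fbar l := SemidirectProduct.inl (SemidirectProduct.inr k₀⁻¹)
  have hd₀ : (((1 : galoisSubgroupOf F K Fbar), d₀)) ∈ liftU (galoisSubgroupOf F K Fbar) (dX F E Fbar l) ⊓
      liftU (galoisSubgroupOf F K Fbar) (dC F E g) :=
    ⟨mem_liftU.mpr ((mem_dX_iff _).mpr rfl), mem_liftU.mpr ((mem_dC_iff _ _).mpr (Subgroup.inv_mem _ hk₀))⟩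
  refine ⟨QuotientGroup.mk P', embK₃ hK ((1 : galoisSubgroupOf F K Fbar), d₀), ⟨_, hd₀, rfl⟩, ?_⟩
  -- the conjugation formula for `m := t n`
  have hσ : ∀ γ : galoisSubgroupOf F K Fbar, n.right.1 * γ * n.right.1⁻¹ ∈ galoisSubgroupOf F K Fbar := fun γ =>
    (hK' _).mpr (fixesTorsion_conj' (hK γ γ.2) n.right.1)
  have key : ∀ (γ : galoisSubgroupOf F K Fbar) (k : ℤ),
      embK₃ hK ((1 : galoisSubgroupOf F K Fbar), d₀) * n * embK₃ hK (γ, igenP s x ^ k) *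
          (embK₃ hK ((1 : galoisSubgroupOf F K Fbar), d₀) * n)⁻¹ =
        embK₃ hK (⟨n.right.1 * γ * n.right.1⁻¹, hσ γ⟩, igenP s (QuotientGroup.mk P') ^ ((n.right.2 : ℤ) * k)) := by
    intro γ k
    rw [mul_inv_rev, show embK₃ hK (1, d₀) * n * embK₃ hK (γ, igenP s x ^ k) * (n⁻¹ * (embK₃ hK (1, d₀))⁻¹) =
      embK₃ hK (1, d₀) * (n * embK₃ hK (γ, igenP s x ^ k) * n⁻¹) * (embK₃ hK (1, d₀))⁻¹ by group,
      conj_embK₃_igenP_zpow hK s n γ x k, ← hP']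
    have hp : outer F E Fbar l ((embK₃ hK (1, d₀)).right * (n.right * ((γ : Fbar ≃ₐ[F] Fbar), 1) * n.right⁻¹) *
        (embK₃ hK (1, d₀)).right⁻¹) = 1 := by
      rw [embK₃_apply, OneMemClass.coe_one]
      show outer F E Fbar l (((1 : Fbar ≃ₐ[F] Fbar), (1 : ℤˣ)) * (n.right * ((γ : Fbar ≃ₐ[F] Fbar), 1) * n.right⁻¹) *
        ((1 : Fbar ≃ₐ[F] Fbar), (1 : ℤˣ))⁻¹) = 1
      rw [Prod.mk_one_one, one_mul, inv_one, mul_one]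
      have e : n.right * ((γ : Fbar ≃ₐ[F] Fbar), (1 : ℤˣ)) * n.right⁻¹ = (n.right.1 * γ * n.right.1⁻¹, 1) := by
        ext <;> simp
      rw [e]
      exact outer_eq_one_of_fixesTorsion (fixesTorsion_conj' (hK γ γ.2) n.right.1)
    rw [piC_conj_mk _ _ _ hp]
    refine SemidirectProduct.ext ?_ ?_
    · show SemidirectProduct.inr k₀⁻¹ * outer F E Fbar l (((1 : galoisSubgroupOf F K Fbar) : Fbar ≃ₐ[F] Fbar), (1 : ℤˣ))
          (SemidirectProduct.inl (U.e P' ^ ((n.right.2 : ℤ) * k))) * (SemidirectProduct.inr k₀⁻¹)⁻¹ =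
        (igenP s (QuotientGroup.mk P') ^ ((n.right.2 : ℤ) * k)).left
      rw [OneMemClass.coe_one, Prod.mk_one_one, map_one, MulAut.one_apply, del_conj_inl, SemidirectProduct.right_inr,
        map_zpow, transl_e, igenP, ← map_zpow, ← map_zpow, SemidirectProduct.left_inl, hk₀def, mul_inv_rev, inv_inv,
        mul_inv_cancel_left]
    · show ((((1 : galoisSubgroupOf F K Fbar) : Fbar ≃ₐ[F] Fbar), (1 : ℤˣ)) : GalPM F Fbar) *
          (n.right * ((γ : Fbar ≃ₐ[F] Fbar), 1) * n.right⁻¹) * (((1 : galoisSubgroupOf F K Fbar) : Fbar ≃ₐ[F] Fbar), (1 : ℤˣ))⁻¹ =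
        (((⟨n.right.1 * γ * n.right.1⁻¹, hσ γ⟩ : galoisSubgroupOf F K Fbar) : Fbar ≃ₐ[F] Fbar),
          (igenP s (QuotientGroup.mk P') ^ ((n.right.2 : ℤ) * k)).right)
      rw [OneMemClass.coe_one, Prod.mk_one_one, one_mul, inv_one, mul_one, igenP, ← map_zpow, SemidirectProduct.right_inl]
      ext <;> simp
  -- the two subgroups coincide
  have hu2 : ((n.right.2 : ℤ)) * (n.right.2 : ℤ) = 1 := by rw [← Units.val_mul, Int.units_mul_self, Units.val_one]
  obtain ⟨m, hm⟩ : ∃ m : PiC F E Fbar l, m = embK₃ hK ((1 : galoisSubgroupOf F K Fbar), d₀) * n := ⟨_, rfl⟩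
  have key' : ∀ (γ : galoisSubgroupOf F K Fbar) (k : ℤ), m * embK₃ hK (γ, igenP s x ^ k) * m⁻¹ =
      embK₃ hK (⟨n.right.1 * γ * n.right.1⁻¹, hσ γ⟩, igenP s (QuotientGroup.mk P') ^ ((n.right.2 : ℤ) * k)) := by
    intro γ k; rw [hm]; exact key γ k
  rw [← hm]
  refine le_antisymm (fun z hz => ?_) (fun z hz => ?_)
  · rw [Subgroup.mem_pointwise_smul_iff_inv_smul_mem, MulAut.smul_def, MulAut.conj_inv_apply] at hz
    obtain ⟨w, hw, hwz⟩ := Subgroup.mem_map.mp hz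
    obtain ⟨j, hj⟩ := Subgroup.mem_zpowers_iff.mp (mem_liftU.mp hw)
    have hz' : z = m * embK₃ hK (w.1, igenP s x ^ j) * m⁻¹ := by
      rw [show (w.1, igenP s x ^ j) = w from Prod.ext rfl hj, hwz]; group
    rw [hz', key']
    exact Subgroup.mem_map.mpr ⟨_, mem_liftU.mpr (Subgroup.zpow_mem _ (Subgroup.mem_zpowers _) _), rfl⟩
  · obtain ⟨w, hw, rfl⟩ := Subgroup.mem_map.mp hz
    obtain ⟨j, hj⟩ := Subgroup.mem_zpowers_iff.mp (mem_liftU.mp hw)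
    rw [Subgroup.mem_pointwise_smul_iff_inv_smul_mem, MulAut.smul_def, MulAut.conj_inv_apply]
    have hγ : n.right.1⁻¹ * (w.1 : Fbar ≃ₐ[F] Fbar) * n.right.1 ∈ galoisSubgroupOf F K Fbar := by
      have h := fixesTorsion_conj' (E := E) (l := l) (hK _ w.1.2) n.right.1⁻¹
      rw [inv_inv] at h
      exact (hK' _).mpr h
    have e := key' ⟨_, hγ⟩ ((n.right.2 : ℤ) * j)
    have e2 : embK₃ hK (⟨n.right.1 * (n.right.1⁻¹ * (w.1 : Fbar ≃ₐ[F] Fbar) * n.right.1) * n.right.1⁻¹, hσ ⟨_, hγ⟩⟩,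
        igenP s (QuotientGroup.mk P') ^ ((n.right.2 : ℤ) * ((n.right.2 : ℤ) * j))) = embK₃ hK w := by
      congr 1
      refine Prod.ext (Subtype.ext ?_) ?_
      · show n.right.1 * (n.right.1⁻¹ * (w.1 : Fbar ≃ₐ[F] Fbar) * n.right.1) * n.right.1⁻¹ = w.1
        group
      · show igenP s (QuotientGroup.mk P') ^ ((n.right.2 : ℤ) * ((n.right.2 : ℤ) * j)) = w.2
        rw [← mul_assoc, hu2, one_mul, hj]
    have hconj : m⁻¹ * embK₃ hK w * m = embK₃ hK (⟨_, hγ⟩, igenP s x ^ ((n.right.2 : ℤ) * j)) := by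
      rw [← e2, ← e]; group
    rw [hconj]
    exact Subgroup.mem_map.mpr ⟨_, mem_liftU.mpr (Subgroup.zpow_mem _ (Subgroup.mem_zpowers _) _), rfl⟩

end Normaliser

end TorsionCuspModel

namespace InitialThetaData

open TorsionMonodromyModel TorsionCuspModel
open scoped WeierstrassCurve.Affine Classical

variable {F K Fbar : Type u} [Field F] [NumberField F] [Field K] [NumberField K] [Algebra F K] [Field Fbar]
  [Algebra F Fbar] [Algebra K Fbar] {E : WeierstrassCurve F} [E.IsElliptic] {l : ℕ} {Pb : BadPlacePredicates K}

/-- **abc-iut-L5-t4's `CuspClassesNormaliserStable` (`hS`) HOLDS at the single-point datum `regeom₄`.**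
[cite: Mochizuki2012, IUTchI Def 6.1 (v) p.158] -/
theorem cuspClassesNormaliserStable_regeom₄ (D₀ : InitialThetaData F K Fbar E l Pb) :
    D₀.regeom₄.CuspClassesNormaliserStable := by
  haveI := D₀.isAlgClosure
  haveI := D₀.isScalarTower
  haveI : NeZero l := ⟨D₀.l_prime.ne_zero⟩
  refine ⟨fun n hn x => ?_⟩
  exact TorsionCuspModel.cuspClassesNormaliserStable₄ D₀.fixesTorsion_of_mem_galoisSubgroupOf Quotient.out
    D₀.mem_galoisSubgroupOf_iff_fixesTorsion QuotientGroup.out_eq' n hn x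

/-- **JOINT NON-VACUITY `{CG, M′ ⊇ (M, hI), hS}` AT ONE DATUM over the same `(V^bad_mod, V̲)`** — the DATA binders and
the normaliser law of abc-iut-L5-d5's `Λ`-assembly / abc-iut-L5-t4's kits, jointly (`hL`, `hA` at `regeom₄`: part C3).
[cite: Mochizuki2012, IUTchI Def 6.1 (v) p.158] -/
theorem exists_cuspGalois_unramified_normaliserStable (D₀ : InitialThetaData F K Fbar E l Pb) :
    ∃ D : InitialThetaData F K Fbar E l Pb, D.VbadMod = D₀.VbadMod ∧ D.V = D₀.V ∧
      ∃ (_ : D.geom.pe.CuspGalois) (_ : D.UnramifiedTorsionMonodromy), D.CuspClassesNormaliserStable :=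
  ⟨D₀.regeom₄, rfl, rfl, D₀.cuspGaloisRegeom₄, D₀.unramifiedTorsionMonodromyRegeom₄,
    D₀.cuspClassesNormaliserStable_regeom₄⟩

end InitialThetaData

end Literature.IUT.HodgeTheaters

end
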